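import Summits.HodgeConjecture.CorCM.MultiFieldWeilUnitsDefectLaw
import HarnessLib

/-!
# MULTI-FIELD WEIL ENGINE — THE GRAM MATRIX OF THE CENTRED INDICATORS: inner products `k(k|Q ∩ T| − |Q||T|)`, the Gram equations of a dependency, and the independent triples
# of the menu (three `(2,2)`-classes or two `(2,2)`-classes and a `(1,3)`-class over one `𝔖₄`-octic field; any three `(2,3)`-classes over one decic field) (census level)

Cell `pub-hodgecm2` (COR-CM), seat b30 gen 39 (2026-08-25); count-neutral own lane MULTI-FIELD WEIL ENGINE (stem `MultiFieldWeil*`), census level (pure linear algebra of finite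
sets), sequel of `CorCM/MultiFieldWeilUnitSeparation.lean` (U1: separation ⟸ linear independence of the centred indicators `k·𝟙_Q − |Q|·𝟙`) and
`CorCM/MultiFieldWeilUnitsDefectLaw.lean` (U2 §2: distinct singletons).  Theorems only; no definition, no named fact, no `sorry`, no `decide`.  HONEST FRAMING: pure finite
combinatorics; `HC_CM` is NOT touched.

* §1 `exists_unitRep` — a representative map `U : Fin r → Fin r` for the fibres of any index map `is` (`U m' = U m ↔ is m' = is m`).
* §2 `sum_cells_mul_cells` — THE INNER PRODUCT of two centred indicators: `⟨k·𝟙_Q − |Q|, k·𝟙_T − |T|⟩ = k(k|Q ∩ T| − |Q||T|)`; `gram_eq_zero_of_sum_smul_eq_zero` — a dependency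
  `Σ_i g_i (k·𝟙_{Q_i} − |Q_i|) = 0` satisfies the Gram equations `Σ_i g_i ⟨v_i, v_j⟩ = 0`.
* §3 THE INDEPENDENT TRIPLES.  `k = 4`: two distinct non-complementary `2`-sets meet in ONE letter (`card_inter_eq_one_of_four`), so their centred indicators are ORTHOGONAL:
  three `2`-sets pairwise meeting once are independent (`linearIndependent_cells_of_pairs_meeting_once`, Gram matrix `16·I`), and two such `2`-sets with any singleton
  (`linearIndependent_cells_of_two_pairs_singleton`, Gram determinant `2¹⁰`).  `k = 5`: three distinct `2`-sets (pairwise meeting at most once, not pairwise disjoint —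
  `not_pairwise_disjoint_three_pairs_five`) are independent (`linearIndependent_cells_of_three_pairs_five`, Gram entries `30` and `5`/`−20`).
  NOT independent, honestly: two singletons `{q}, {q'}` with the `2`-set `{q, q'}` or its complement (`k = 4`); four `2`-sets forming a triangle plus the disjoint edge (`k = 5`).
USE (sequel, the units menu): per `𝔄₄`/`𝔖₄`-octic field any THREE pairwise non-isogenous simple CM fourfolds through `k` not of the shape «two `(1,3)`-classes and one `(2,2)`-class»;
per decic field with `2`-transitive quintic part any THREE pairwise non-isogenous `(2,3)`/`(3,2)`-fivefolds.
[cite: Lang2002, XIII §4; XV §1] [cite: DixonMortimer1996, §2.1]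

## References
* [Lang2002] S. Lang, *Algebra*, GTM 211, XIII §4 (linear independence, rank), XV §1 (bilinear forms, Gram matrices).
* [DixonMortimer1996] J. D. Dixon, B. Mortimer, *Permutation Groups*, GTM 163, §2.1.
-/

noncomputable section

namespace Summit.HodgeConjecture.CorCM.MultiFieldWeil

open Finset

open scoped Classical

/-! ## §1 Unit representatives -/

section UnitRep

/-- **A representative map for the fibres of an index map.** [folklore] -/
theorem exists_unitRep {I : Type} {r : ℕ} (is : Fin r → I) : ∃ U : Fin r → Fin r, ∀ m m' : Fin r, U m' = U m ↔ is m' = is m := by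
  have hne : ∀ m : Fin r, (Finset.univ.filter fun m' : Fin r => is m' = is m).Nonempty := fun m => ⟨m, by simp⟩
  have hmem : ∀ m : Fin r, is ((Finset.univ.filter fun m' : Fin r => is m' = is m).min' (hne m)) = is m := fun m =>
    (Finset.mem_filter.1 (Finset.min'_mem _ (hne m))).2
  refine ⟨fun m => (Finset.univ.filter fun m' : Fin r => is m' = is m).min' (hne m), fun m m' => ⟨fun h => ?_, fun h => ?_⟩⟩
  · rw [← hmem m', ← hmem m]
    exact congrArg is h
  · have hs : (Finset.univ.filter fun x : Fin r => is x = is m') = Finset.univ.filter fun x : Fin r => is x = is m := by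
      ext x; simp only [Finset.mem_filter, Finset.mem_univ, true_and, h]
    simp only [hs]

end UnitRep

/-! ## §2 Inner products of centred indicators; the Gram equations -/

section Gram

variable {k : ℕ}

/-- **THE INNER PRODUCT OF TWO CENTRED INDICATORS**: `Σ_y (k·[y ∈ Q] − |Q|)(k·[y ∈ T] − |T|) = k(k|Q ∩ T| − |Q||T|)`. [cite: Lang2002, XV §1] -/
theorem sum_cells_mul_cells (Q T : Finset (Fin k)) :
    (∑ y : Fin k, ((k : ℚ) * (if y ∈ Q then 1 else 0) - Q.card) * ((k : ℚ) * (if y ∈ T then 1 else 0) - T.card)) =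
      (k : ℚ) * ((k : ℚ) * (Q ∩ T).card - Q.card * T.card) := by
  have hQT : (∑ y : Fin k, (if y ∈ Q then (1 : ℚ) else 0) * (if y ∈ T then 1 else 0)) = (Q ∩ T).card := by
    rw [Finset.sum_congr rfl fun y _ => show (if y ∈ Q then (1 : ℚ) else 0) * (if y ∈ T then 1 else 0) = if y ∈ Q ∩ T then 1 else 0 by
      by_cases hq : y ∈ Q <;> by_cases ht : y ∈ T <;> simp [hq, ht, Finset.mem_inter]]
    rw [Finset.sum_boole, Finset.filter_mem_eq_inter, Finset.univ_inter]
  have hQ : (∑ y : Fin k, (if y ∈ Q then (1 : ℚ) else 0)) = Q.card := by rw [Finset.sum_boole, Finset.filter_mem_eq_inter, Finset.univ_inter]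
  have hT : (∑ y : Fin k, (if y ∈ T then (1 : ℚ) else 0)) = T.card := by rw [Finset.sum_boole, Finset.filter_mem_eq_inter, Finset.univ_inter]
  have hexp : ∀ y : Fin k, ((k : ℚ) * (if y ∈ Q then 1 else 0) - Q.card) * ((k : ℚ) * (if y ∈ T then 1 else 0) - T.card) =
      (k : ℚ) ^ 2 * ((if y ∈ Q then (1 : ℚ) else 0) * (if y ∈ T then 1 else 0)) - (k : ℚ) * T.card * (if y ∈ Q then (1 : ℚ) else 0) -
        (k : ℚ) * Q.card * (if y ∈ T then (1 : ℚ) else 0) + (Q.card : ℚ) * T.card := fun y => by ring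
  rw [Finset.sum_congr rfl fun y _ => hexp y, Finset.sum_add_distrib, Finset.sum_sub_distrib, Finset.sum_sub_distrib, ← Finset.mul_sum, ← Finset.mul_sum, ← Finset.mul_sum,
    hQT, hQ, hT, Finset.sum_const, Finset.card_univ, Fintype.card_fin, nsmul_eq_mul]
  ring

/-- **THE GRAM EQUATIONS OF A DEPENDENCY**: if `Σ_i g_i (k·𝟙_{Q_i} − |Q_i|) = 0` then `Σ_i g_i · k(k|Q_i ∩ Q_j| − |Q_i||Q_j|) = 0` for every `j`. [cite: Lang2002, XV §1] -/
theorem gram_eq_zero_of_sum_smul_eq_zero {ι : Type} [Fintype ι] (Q : ι → Finset (Fin k)) {g : ι → ℚ}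
    (hg : (∑ i, g i • fun y : Fin k => ((k : ℚ) * (if y ∈ Q i then 1 else 0) - (Q i).card)) = 0) (j : ι) :
    (∑ i, g i * ((k : ℚ) * ((k : ℚ) * (Q i ∩ Q j).card - (Q i).card * (Q j).card))) = 0 := by
  have hy : ∀ y : Fin k, (∑ i, g i * ((k : ℚ) * (if y ∈ Q i then 1 else 0) - (Q i).card)) = 0 := fun y => by
    have h := congrFun hg y
    rw [Finset.sum_apply, Pi.zero_apply] at h
    simpa only [Pi.smul_apply, smul_eq_mul] using h
  calc (∑ i, g i * ((k : ℚ) * ((k : ℚ) * (Q i ∩ Q j).card - (Q i).card * (Q j).card)))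
      = ∑ i, ∑ y : Fin k, g i * (((k : ℚ) * (if y ∈ Q i then 1 else 0) - (Q i).card) * ((k : ℚ) * (if y ∈ Q j then 1 else 0) - (Q j).card)) :=
        Finset.sum_congr rfl fun i _ => by rw [← sum_cells_mul_cells, Finset.mul_sum]
    _ = ∑ y : Fin k, ∑ i, g i * (((k : ℚ) * (if y ∈ Q i then 1 else 0) - (Q i).card) * ((k : ℚ) * (if y ∈ Q j then 1 else 0) - (Q j).card)) :=
        Finset.sum_comm
    _ = ∑ y : Fin k, (∑ i, g i * ((k : ℚ) * (if y ∈ Q i then 1 else 0) - (Q i).card)) * ((k : ℚ) * (if y ∈ Q j then 1 else 0) - (Q j).card) :=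
        Finset.sum_congr rfl fun y _ => by rw [Finset.sum_mul]; exact Finset.sum_congr rfl fun i _ => by ring
    _ = 0 := Finset.sum_eq_zero fun y _ => by rw [hy y, zero_mul]

/-- Sums over an index type with exactly three elements. [folklore] -/
theorem sum_eq_three {ι : Type} [Fintype ι] (i₁ i₂ i₃ : ι) (h₁₂ : i₁ ≠ i₂) (h₁₃ : i₁ ≠ i₃) (h₂₃ : i₂ ≠ i₃) (huniv : ∀ i, i = i₁ ∨ i = i₂ ∨ i = i₃) (f : ι → ℚ) :
    (∑ i, f i) = f i₁ + f i₂ + f i₃ := by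
  have hu : (Finset.univ : Finset ι) = {i₁, i₂, i₃} := by
    ext i; simp only [Finset.mem_univ, Finset.mem_insert, Finset.mem_singleton, true_iff]; exact huniv i
  rw [hu, Finset.sum_insert (by simp [h₁₂, h₁₃]), Finset.sum_insert (by simp [h₂₃]), Finset.sum_singleton, add_assoc]

end Gram

/-! ## §3 The independent triples -/

section Triples

variable {k : ℕ}

/-- Two distinct `2`-sets meet in at most one letter. [folklore] -/
theorem card_inter_le_one_of_ne {Q Q' : Finset (Fin k)} (hQ : Q.card = 2) (hQ' : Q'.card = 2) (hne : Q' ≠ Q) : (Q ∩ Q').card ≤ 1 := by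
  by_contra hlt
  push Not at hlt
  have h1 : Q ∩ Q' = Q := Finset.eq_of_subset_of_card_le Finset.inter_subset_left (by rw [hQ]; omega)
  have h2 : Q ⊆ Q' := by rw [← h1]; exact Finset.inter_subset_right
  exact hne (Finset.eq_of_subset_of_card_le h2 (by rw [hQ, hQ'])).symm

/-- On four letters two distinct non-complementary `2`-sets meet in exactly one letter. [folklore] -/
theorem card_inter_eq_one_of_four (hk : k = 4) {Q Q' : Finset (Fin k)} (hQ : Q.card = 2) (hQ' : Q'.card = 2) (hne : Q' ≠ Q) (hnc : Q' ≠ Qᶜ) : (Q ∩ Q').card = 1 := by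
  have hle := card_inter_le_one_of_ne hQ hQ' hne
  by_contra h1
  have h0 : (Q ∩ Q').card = 0 := by omega
  have hdisj : Disjoint Q Q' := Finset.disjoint_iff_inter_eq_empty.2 (Finset.card_eq_zero.1 h0)
  have hsub : Q' ⊆ Qᶜ := fun y hy => Finset.mem_compl.2 fun hyQ => Finset.disjoint_left.1 hdisj hyQ hy
  have hc : (Qᶜ).card = 2 := by rw [Finset.card_compl, Fintype.card_fin, hQ, hk]
  exact hnc (Finset.eq_of_subset_of_card_le hsub (by rw [hc, hQ']))

/-- On five letters three `2`-sets are not pairwise disjoint. [folklore] -/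
theorem not_pairwise_disjoint_three_pairs_five (hk : k = 5) {Q₁ Q₂ Q₃ : Finset (Fin k)} (h₁ : Q₁.card = 2) (h₂ : Q₂.card = 2) (h₃ : Q₃.card = 2) :
    ¬ ((Q₁ ∩ Q₂).card = 0 ∧ (Q₁ ∩ Q₃).card = 0 ∧ (Q₂ ∩ Q₃).card = 0) := by
  rintro ⟨h12, h13, h23⟩
  have d12 : Disjoint Q₁ Q₂ := Finset.disjoint_iff_inter_eq_empty.2 (Finset.card_eq_zero.1 h12)
  have d13 : Disjoint Q₁ Q₃ := Finset.disjoint_iff_inter_eq_empty.2 (Finset.card_eq_zero.1 h13)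
  have d23 : Disjoint Q₂ Q₃ := Finset.disjoint_iff_inter_eq_empty.2 (Finset.card_eq_zero.1 h23)
  have hu : (Q₁ ∪ Q₂ ∪ Q₃).card = 6 := by
    rw [Finset.card_union_of_disjoint (Finset.disjoint_union_left.2 ⟨d13, d23⟩), Finset.card_union_of_disjoint d12, h₁, h₂, h₃]
  have := Finset.card_le_univ (Q₁ ∪ Q₂ ∪ Q₃)
  rw [hu, Fintype.card_fin, hk] at this
  omega

/-- **THREE `2`-SETS ON FOUR LETTERS PAIRWISE MEETING ONCE HAVE INDEPENDENT CENTRED INDICATORS** (they are pairwise orthogonal of square norm `16`). [cite: Lang2002, XV §1] -/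
theorem linearIndependent_cells_of_pairs_meeting_once (hk : k = 4) {ι : Type} [Fintype ι] (Q : ι → Finset (Fin k)) (hcard : ∀ i, (Q i).card = 2)
    (hint : ∀ i j, i ≠ j → (Q i ∩ Q j).card = 1) :
    LinearIndependent ℚ fun i : ι => fun y : Fin k => ((k : ℚ) * (if y ∈ Q i then 1 else 0) - (Q i).card) := by
  subst hk
  rw [Fintype.linearIndependent_iff]
  intro g hg j
  have hE := gram_eq_zero_of_sum_smul_eq_zero Q hg j
  rw [Finset.sum_eq_single_of_mem j (Finset.mem_univ j) fun i _ hij => by rw [hint i j hij, hcard i, hcard j]; norm_num, Finset.inter_self, hcard j] at hE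
  norm_num at hE
  exact hE

/-- **TWO `2`-SETS MEETING ONCE AND A SINGLETON ON FOUR LETTERS HAVE INDEPENDENT CENTRED INDICATORS** (Gram matrix `[[16,0,±8],[0,16,±8],[±8,±8,12]]`, determinant `2¹⁰`).
[cite: Lang2002, XV §1] -/
theorem linearIndependent_cells_of_two_pairs_singleton (hk : k = 4) {ι : Type} [Fintype ι] (i₁ i₂ i₃ : ι) (h₁₂ : i₁ ≠ i₂) (h₁₃ : i₁ ≠ i₃) (h₂₃ : i₂ ≠ i₃)
    (huniv : ∀ i, i = i₁ ∨ i = i₂ ∨ i = i₃) (Q : ι → Finset (Fin k)) (hc₁ : (Q i₁).card = 2) (hc₂ : (Q i₂).card = 2) (hc₃ : (Q i₃).card = 1)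
    (hint : (Q i₁ ∩ Q i₂).card = 1) :
    LinearIndependent ℚ fun i : ι => fun y : Fin k => ((k : ℚ) * (if y ∈ Q i then 1 else 0) - (Q i).card) := by
  subst hk
  rw [Fintype.linearIndependent_iff]
  intro g hg
  have E₁ := gram_eq_zero_of_sum_smul_eq_zero Q hg i₁
  have E₂ := gram_eq_zero_of_sum_smul_eq_zero Q hg i₂
  have E₃ := gram_eq_zero_of_sum_smul_eq_zero Q hg i₃
  rw [sum_eq_three i₁ i₂ i₃ h₁₂ h₁₃ h₂₃ huniv] at E₁ E₂ E₃
  rw [Finset.inter_comm (Q i₂) (Q i₁), Finset.inter_comm (Q i₃) (Q i₁)] at E₁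
  rw [Finset.inter_comm (Q i₃) (Q i₂)] at E₂
  simp only [Finset.inter_self, hc₁, hc₂, hc₃, hint] at E₁ E₂ E₃
  have ht₁ : (Q i₁ ∩ Q i₃).card ≤ 1 := (Finset.card_le_card Finset.inter_subset_right).trans hc₃.le
  have ht₂ : (Q i₂ ∩ Q i₃).card ≤ 1 := (Finset.card_le_card Finset.inter_subset_right).trans hc₃.le
  have hboth : g i₁ = 0 ∧ g i₂ = 0 ∧ g i₃ = 0 := by
    rcases Nat.le_one_iff_eq_zero_or_eq_one.1 ht₁ with ha | ha <;> rcases Nat.le_one_iff_eq_zero_or_eq_one.1 ht₂ with hb | hb <;>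
      · simp only [ha, hb] at E₁ E₂ E₃; norm_num at E₁ E₂ E₃; exact ⟨by linarith, by linarith, by linarith⟩
  intro i
  rcases huniv i with rfl | rfl | rfl
  exacts [hboth.1, hboth.2.1, hboth.2.2]

/-- **THREE DISTINCT `2`-SETS ON FIVE LETTERS HAVE INDEPENDENT CENTRED INDICATORS** (Gram entries `30` on the diagonal, `5` or `−20` off it, never three times `−20`).
[cite: Lang2002, XV §1] -/
theorem linearIndependent_cells_of_three_pairs_five (hk : k = 5) {ι : Type} [Fintype ι] (i₁ i₂ i₃ : ι) (h₁₂ : i₁ ≠ i₂) (h₁₃ : i₁ ≠ i₃) (h₂₃ : i₂ ≠ i₃)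
    (huniv : ∀ i, i = i₁ ∨ i = i₂ ∨ i = i₃) (Q : ι → Finset (Fin k)) (hc₁ : (Q i₁).card = 2) (hc₂ : (Q i₂).card = 2) (hc₃ : (Q i₃).card = 2)
    (hne₁₂ : Q i₂ ≠ Q i₁) (hne₁₃ : Q i₃ ≠ Q i₁) (hne₂₃ : Q i₃ ≠ Q i₂) :
    LinearIndependent ℚ fun i : ι => fun y : Fin k => ((k : ℚ) * (if y ∈ Q i then 1 else 0) - (Q i).card) := by
  have hnot := not_pairwise_disjoint_three_pairs_five hk hc₁ hc₂ hc₃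
  have ht₁₂ := card_inter_le_one_of_ne hc₁ hc₂ hne₁₂
  have ht₁₃ := card_inter_le_one_of_ne hc₁ hc₃ hne₁₃
  have ht₂₃ := card_inter_le_one_of_ne hc₂ hc₃ hne₂₃
  subst hk
  rw [Fintype.linearIndependent_iff]
  intro g hg
  have E₁ := gram_eq_zero_of_sum_smul_eq_zero Q hg i₁
  have E₂ := gram_eq_zero_of_sum_smul_eq_zero Q hg i₂
  have E₃ := gram_eq_zero_of_sum_smul_eq_zero Q hg i₃
  rw [sum_eq_three i₁ i₂ i₃ h₁₂ h₁₃ h₂₃ huniv] at E₁ E₂ E₃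
  rw [Finset.inter_comm (Q i₂) (Q i₁), Finset.inter_comm (Q i₃) (Q i₁)] at E₁
  rw [Finset.inter_comm (Q i₃) (Q i₂)] at E₂
  simp only [Finset.inter_self, hc₁, hc₂, hc₃] at E₁ E₂ E₃
  have hboth : g i₁ = 0 ∧ g i₂ = 0 ∧ g i₃ = 0 := by
    rcases Nat.le_one_iff_eq_zero_or_eq_one.1 ht₁₂ with ha | ha <;> rcases Nat.le_one_iff_eq_zero_or_eq_one.1 ht₁₃ with hb | hb <;>
      rcases Nat.le_one_iff_eq_zero_or_eq_one.1 ht₂₃ with hc | hc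
    · exact absurd ⟨ha, hb, hc⟩ hnot
    all_goals simp only [ha, hb, hc] at E₁ E₂ E₃; norm_num at E₁ E₂ E₃; exact ⟨by linarith, by linarith, by linarith⟩
  intro i
  rcases huniv i with rfl | rfl | rfl
  exacts [hboth.1, hboth.2.1, hboth.2.2]

end Triples

end Summit.HodgeConjecture.CorCM.MultiFieldWeil

end
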